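import Summits.MatrixMultiplication.MatrixMultiplication.Theorems.AbelianSTPPCensusShapeCertVQSearchP
import Summits.MatrixMultiplication.MatrixMultiplication.Theorems.AbelianSTPPCensusShapeCertVQEvalP406a
import Summits.MatrixMultiplication.MatrixMultiplication.Theorems.AbelianSTPPCensusShapeCertVQEvalP406b

/-!
# Abelian STPP census — the budgeted vQ certificate at order 406, assembled from its path segments

Cell mm-stpp, rung F-M1; successor kernel item VQ-CERT in support of the closed crux item stmt-MatrixMultiplication-19191; seat
mm-stpp-vp-p2 (gen 1); support file (no definitions, no kernel search).  Folds the kernel-evaluated path segments of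
`…ShapeCertVQEvalP406a…` into `ShapeCertVQ.checkQE 406 = true` with `pathSegQE_append` / `pathOK_of_seg` / `pathSeg_single_of_child` /
`checkQE_of_pathOK_nil` (`…ShapeCertVQSearchP`).
WHAT THIS IS NOT: a Boolean fact; no statement about STPP families or `ω` by itself.
-/

set_option linter.dupNamespace false -- `MatrixMultiplication.MatrixMultiplication` (summit = problem, D-0017)
set_option autoImplicit false

namespace Summit.MatrixMultiplication.MatrixMultiplication.Theorems.ShapeCertVQ

/-- the node `[]` of order `406` is accepted by the budgeted search -/
theorem pok_406_r : PathOK 406 [] :=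
  pathOK_of_seg (pathSegQE_append (pathSegQE_append (pathSegQE_append (pathSegQE_append (pathSegQE_append ps_406_r_0 ps_406_r_93) ps_406_r_95) ps_406_r_97) ps_406_r_105) ps_406_r_3874) (lt_of_lt_of_le (pathNode_pool_lt 406 []) (by norm_num)) (by norm_num)

/-- **budgeted vQ certificate check at order `406`**, assembled from its path segments -/
theorem checkQE_406 : checkQE 406 = true := checkQE_of_pathOK_nil pok_406_r

end Summit.MatrixMultiplication.MatrixMultiplication.Theorems.ShapeCertVQ
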